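import Mathlib
import HarnessLib

/-!
# The tilt-hull lemma in `lintegral` form (stub `stub_tiltHull`; finite consultation)

Crux `Summit.AtomisticToContinuum.HydrodynamicLimit.Theses.TwoClocks.TransferEntropyClock` (stmt-AtomisticToContinuum-16625),
line `Sketch` (card equilibrium-hull-finite-consultation), registered stub S2 `stub_tiltHull : TiltHullLintegral` (def
re-declared verbatim from the line skeleton `Cruxes/TransferEntropyClock/Lines/Sketch.lean`, this file's namespace).

WHAT. On a probability space, let `Y₁, …, Yₙ` be a.e.-measurable real observables whose exponential moments at the
`2n` vertex tilts `± rᵢ Yᵢ` (`rᵢ > 0`) are all `≤ exp B` (`B ≥ 0`):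
`∫ exp(rᵢ Yᵢ) dμ ≤ exp B` and `∫ exp(−rᵢ Yᵢ) dμ ≤ exp B`.  Then for every tilt vector `ξ` in the cross-polytope
`Σᵢ |ξᵢ| / rᵢ ≤ 1` the exponential moment of the combined tilt obeys the same bound,
`∫ exp(Σᵢ ξᵢ Yᵢ) dμ ≤ exp B` — all integrals being lower Lebesgue integrals of `ENNReal.ofReal ∘ Real.exp`, the
currency of the window large-deviation nodes of the route.  This is FINITE CONSULTATION: pointwise-in-the-functional
thresholds become one threshold on the unit coefficient ball of a finite span, consulting the black box `2n` times.

HOW (convexity of the log-mgf in the tilt, run as a generalised Hölder inequality).  With the weights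
`pᵢ = |ξᵢ| / rᵢ ≥ 0`, `Σ pᵢ ≤ 1`, and the consulted vertex coefficients `cᵢ = rᵢ` if `ξᵢ ≥ 0`, `cᵢ = −rᵢ` otherwise,
one has `cᵢ pᵢ = ξᵢ`, whence pointwise `exp(Σ ξᵢ Yᵢ) = ∏ᵢ exp(cᵢ Yᵢ)^{pᵢ}` (`Real.exp_sum`, `Real.exp_mul`,
`ENNReal.ofReal_prod_of_nonneg`, `ENNReal.ofReal_rpow_of_pos`).  The generalised Hölder inequality with a
distinguished factor `ENNReal.lintegral_mul_prod_norm_pow_le`, fed with the constant factor `1` carrying the slack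
exponent `1 − Σ pᵢ` (harmless on a probability space), gives `∫ ∏ᵢ fᵢ^{pᵢ} ≤ ∏ᵢ (∫ fᵢ)^{pᵢ}`
(`lintegral_prod_rpow_le_of_sum_le_one`); each factor is `≤ (exp B)^{pᵢ}` by the vertex hypothesis of the right
sign (`ENNReal.rpow_le_rpow`), and `∏ᵢ (exp B)^{pᵢ} = exp(B Σ pᵢ) ≤ exp B` as `B ≥ 0`, `Σ pᵢ ≤ 1`.

References: folklore (Hölder's inequality / convexity of cumulant generating functions); e.g. A. Dembo, O. Zeitouni,
*Large Deviations Techniques and Applications*, 2nd ed. (1998), Lemma 2.2.5 and §2.3.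
-/

noncomputable section

open MeasureTheory Filter Set Topology
open scoped ENNReal

namespace Summit.AtomisticToContinuum.HydrodynamicLimit.Theorems.TransferEntropyClockTiltHull

/-- registered stub signature S2 of line Sketch, crux TransferEntropyClock (stmt-16625) — pure measure theory (convexity of
the log-mgf in the tilt vector), not a cited fact -/
def TiltHullLintegral : Prop :=
  ∀ (Ω : Type) [MeasurableSpace Ω] (μ : Measure Ω) [IsProbabilityMeasure μ] (n : ℕ) (Y : Fin n → Ω → ℝ),
    (∀ i, AEMeasurable (Y i) μ) → ∀ (r : Fin n → ℝ) (B : ℝ), (∀ i, 0 < r i) → 0 ≤ B →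
    (∀ i, ∫⁻ ω, ENNReal.ofReal (Real.exp (r i * Y i ω)) ∂μ ≤ ENNReal.ofReal (Real.exp B)) →
    (∀ i, ∫⁻ ω, ENNReal.ofReal (Real.exp (-r i * Y i ω)) ∂μ ≤ ENNReal.ofReal (Real.exp B)) →
    ∀ ξ : Fin n → ℝ, ∑ i, |ξ i| / r i ≤ 1 →
      ∫⁻ ω, ENNReal.ofReal (Real.exp (∑ i, ξ i * Y i ω)) ∂μ ≤ ENNReal.ofReal (Real.exp B)

/-! ### Two elementary tools -/

/-- **Generalised Hölder inequality with slack on a probability space**: for a.e.-measurable `fᵢ : Ω → ℝ≥0∞` and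
nonnegative exponents with `Σ_{i ∈ s} pᵢ ≤ 1`, `∫ ∏_{i ∈ s} fᵢ^{pᵢ} dμ ≤ ∏_{i ∈ s} (∫ fᵢ dμ)^{pᵢ}`.  (The missing
mass `1 − Σ pᵢ` is carried by the constant factor `1`, whose integral is `μ univ = 1`;
`ENNReal.lintegral_mul_prod_norm_pow_le`.) [folklore] -/
theorem lintegral_prod_rpow_le_of_sum_le_one {Ω ι : Type*} [MeasurableSpace Ω] {μ : Measure Ω}
    [IsProbabilityMeasure μ] (s : Finset ι) {f : ι → Ω → ℝ≥0∞} (hf : ∀ i ∈ s, AEMeasurable (f i) μ)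
    {p : ι → ℝ} (hp : ∀ i ∈ s, 0 ≤ p i) (hp1 : ∑ i ∈ s, p i ≤ 1) :
    ∫⁻ ω, ∏ i ∈ s, f i ω ^ p i ∂μ ≤ ∏ i ∈ s, (∫⁻ ω, f i ω ∂μ) ^ p i := by
  have h := ENNReal.lintegral_mul_prod_norm_pow_le s (g := fun _ => (1 : ℝ≥0∞)) aemeasurable_const hf
    (1 - ∑ i ∈ s, p i) (sub_add_cancel _ _) (sub_nonneg.mpr hp1) hp
  simpa only [ENNReal.one_rpow, one_mul, lintegral_const, measure_univ, mul_one] using h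

/-- One tilted factor: if `c * e = a` then `(ofReal (exp (c y)))^e = ofReal (exp (a y))` (`Real.exp_mul`,
`ENNReal.ofReal_rpow_of_pos`). [folklore] -/
theorem ofReal_exp_rpow_eq {c e a : ℝ} (h : c * e = a) (y : ℝ) :
    ENNReal.ofReal (Real.exp (c * y)) ^ e = ENNReal.ofReal (Real.exp (a * y)) := by
  rw [ENNReal.ofReal_rpow_of_pos (Real.exp_pos _), ← Real.exp_mul, mul_right_comm, h]

/-! ### The tilt-hull lemma -/

/-- **S2 — the tilt-hull lemma (finite consultation), `lintegral` form.**  On a probability space, if the `2n`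
vertex exponential moments `∫ exp(± rᵢ Yᵢ) dμ` (`rᵢ > 0`) are `≤ exp B` with `B ≥ 0`, then
`∫ exp(Σ ξᵢ Yᵢ) dμ ≤ exp B` for every `ξ` in the cross-polytope `Σ |ξᵢ| / rᵢ ≤ 1`: write
`exp(Σ ξᵢ Yᵢ) = ∏ exp(cᵢ Yᵢ)^{pᵢ}` with `pᵢ = |ξᵢ| / rᵢ`, `cᵢ = ± rᵢ` the sign of `ξᵢ`, apply the generalised
Hölder inequality with slack `lintegral_prod_rpow_le_of_sum_le_one`, bound each factor by the vertex hypothesis of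
the right sign, and use `∏ (exp B)^{pᵢ} = exp(B Σ pᵢ) ≤ exp B`. [folklore] -/
theorem stub_tiltHull : TiltHullLintegral := by
  intro Ω _ μ _ n Y hY r B hr hB hplus hminus ξ hξ
  -- Hölder weights `p i = |ξ i| / r i` and consulted vertex coefficients `c i = ± r i`
  obtain ⟨p, hp_def⟩ : ∃ p : Fin n → ℝ, p = fun i => |ξ i| / r i := ⟨_, rfl⟩
  obtain ⟨c, hc_def⟩ : ∃ c : Fin n → ℝ, c = fun i => if 0 ≤ ξ i then r i else -r i := ⟨_, rfl⟩
  have hp0 : ∀ i, 0 ≤ p i := fun i => by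
    rw [hp_def]
    exact div_nonneg (abs_nonneg _) (hr i).le
  have hp1 : ∑ i, p i ≤ 1 := by simpa only [hp_def] using hξ
  have hcp : ∀ i, c i * p i = ξ i := by
    intro i
    have hri : r i ≠ 0 := (hr i).ne'
    simp only [hc_def, hp_def]
    split_ifs with h
    · rw [abs_of_nonneg h]
      field_simp
    · rw [abs_of_neg (not_le.mp h)]
      field_simp
  have hcY : ∀ i, AEMeasurable (fun ω => ENNReal.ofReal (Real.exp (c i * Y i ω))) μ := fun i =>
    ENNReal.measurable_ofReal.comp_aemeasurable
      (Real.measurable_exp.comp_aemeasurable ((hY i).const_mul (c i)))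
  have hcB : ∀ i, ∫⁻ ω, ENNReal.ofReal (Real.exp (c i * Y i ω)) ∂μ ≤ ENNReal.ofReal (Real.exp B) := by
    intro i
    simp only [hc_def]
    split_ifs
    · exact hplus i
    · exact hminus i
  -- pointwise factorisation of the tilted density over the consulted vertices
  have hpt : ∀ ω, ENNReal.ofReal (Real.exp (∑ i, ξ i * Y i ω)) =
      ∏ i, ENNReal.ofReal (Real.exp (c i * Y i ω)) ^ p i := by
    intro ω
    rw [Real.exp_sum, ENNReal.ofReal_prod_of_nonneg fun i _ => (Real.exp_pos _).le]
    exact Finset.prod_congr rfl fun i _ => (ofReal_exp_rpow_eq (hcp i) _).symm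
  calc ∫⁻ ω, ENNReal.ofReal (Real.exp (∑ i, ξ i * Y i ω)) ∂μ
      = ∫⁻ ω, ∏ i, ENNReal.ofReal (Real.exp (c i * Y i ω)) ^ p i ∂μ := lintegral_congr hpt
    _ ≤ ∏ i, (∫⁻ ω, ENNReal.ofReal (Real.exp (c i * Y i ω)) ∂μ) ^ p i :=
        lintegral_prod_rpow_le_of_sum_le_one Finset.univ (fun i _ => hcY i) (fun i _ => hp0 i) hp1
    _ ≤ ∏ i, ENNReal.ofReal (Real.exp B) ^ p i :=
        Finset.prod_le_prod (fun _ _ => zero_le) fun i _ => ENNReal.rpow_le_rpow (hcB i) (hp0 i)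
    _ = ENNReal.ofReal (Real.exp (B * ∑ i, p i)) := by
        rw [Finset.mul_sum, Real.exp_sum, ENNReal.ofReal_prod_of_nonneg fun i _ => (Real.exp_pos _).le]
        exact Finset.prod_congr rfl fun i _ => by
          rw [ENNReal.ofReal_rpow_of_pos (Real.exp_pos _), ← Real.exp_mul]
    _ ≤ ENNReal.ofReal (Real.exp B) :=
        ENNReal.ofReal_le_ofReal (Real.exp_le_exp.mpr (mul_le_of_le_one_right hB hp1))

end Summit.AtomisticToContinuum.HydrodynamicLimit.Theorems.TransferEntropyClockTiltHull

end
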